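import Literature.MathematicalPhysics.QuantumFieldTheory.OSLogSlotExplicit
import Mathlib.Analysis.SpecialFunctions.Gaussian.GaussianIntegral
import Mathlib.Analysis.SpecialFunctions.ImproperIntegrals
import HarnessLib

/-!
# The slot and tube constants as explicit functions of the Gaussian window (towards OS II Thm. 4.1 (4.5))

Topic `Literature/MathematicalPhysics/QuantumFieldTheory`; support file for the temperedness
estimate (4.5) of Osterwalder–Schrader II, Thm. 4.1. The explicit bound of the density of the
skeleton distribution (`OSRegularisedDensityWindow`) involves the maximal slot bound
`slotBmax b C N` (integrals of the logarithmic weights of Gaussian profiles) and the tube constant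
`l1TubeBound (π/2) b 0 (K+1) 1 0 c`; for the inverse-power dependence on the time gap the window `b`
is taken `~ 1/|log gap|`, so their dependence on `b` must be explicit:

* `logWindowConst b N = 2ᴺ (e^{1/(4b)} + e^{(N+1)²/(4b)})` and
  `setIntegral_exp_neg_mul_log_sq_le`: `∫₀^∞ e^{-b log²u} (1+u)ᴺ du/u ≤ logWindowConst b N`;
* `integral_norm_logW_mul_pow_le` — `∫ ‖logW b θ u‖ (1+|u|)ᴺ du ≤ M · logWindowConst b N` for
  `‖θ‖ ≤ M`; `slotB_le` — `slotB i b C N θ ≤ C (M · logWindowConst b N)ᵏ`;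
  `slotBmax_le` — for Gaussian profiles (`M = 1`) and constant `N`,
  `slotBmax b C N ≤ (max C) · (logWindowConst b N)ᵏ`;
* `l1TubeBound_unit_eq` — `l1TubeBound (π/2) b 0 (K+1) 1 0 c = e^{2bc₁²} √(π/(2b)) · tubeTail K c`
  (`c₁ = (c + π/2)/2`, `tubeTail` the `b`-free integral `∫ e^{-2π(c₁-c)‖p‖} dp`).

## References

* K. Osterwalder, R. Schrader, *Axioms for Euclidean Green's functions II*, Comm. Math. Phys.
  42 (1975) 281–305, Thm. 4.1 (4.5), Ch. VI.1. [OsterwalderSchraderCMP1975]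
-/

noncomputable section

open MeasureTheory Set Filter Real
open _root_.Topology
open scoped SchwartzMap

namespace Literature.MathematicalPhysics.QuantumFieldTheory

open Literature.Analysis.Complex

/-! ### The one-dimensional window integral -/

/-- The explicit constant `2ᴺ (e^{1/(4b)} + e^{(N+1)²/(4b)})`. [folklore] -/
def logWindowConst (b : ℝ) (N : ℕ) : ℝ := 2 ^ N * (Real.exp (1 / (4 * b)) + Real.exp (((N : ℝ) + 1) ^ 2 / (4 * b)))

/-- `logWindowConst > 0`. [folklore] -/
theorem logWindowConst_pos (b : ℝ) (N : ℕ) : 0 < logWindowConst b N := by unfold logWindowConst; positivity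

/-- Pointwise bound of the window integrand on `(0, 1]`. [folklore] -/
theorem exp_neg_mul_log_sq_le_of_le_one {b : ℝ} (hb : 0 < b) (N : ℕ) {u : ℝ} (hu0 : 0 < u) (hu1 : u ≤ 1) :
    Real.exp (-b * (Real.log u) ^ 2) * (1 + u) ^ N / u ≤ 2 ^ N * Real.exp (1 / (4 * b)) := by
  have h1 : (1 + u) ^ N ≤ 2 ^ N := pow_le_pow_left₀ (by linarith) (by linarith) N
  have h2 : Real.exp (-b * (Real.log u) ^ 2) / u ≤ Real.exp (1 / (4 * b)) := by
    have hu' : u = Real.exp (Real.log u) := (Real.exp_log hu0).symm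
    have h3 := exp_neg_mul_sq_mul_exp_le hb (-1) (Real.log u)
    rw [show (-1 : ℝ) * Real.log u = -Real.log u by ring, Real.exp_neg, ← hu'] at h3
    rwa [div_eq_mul_inv, show ((-1 : ℝ)) ^ 2 = 1 by norm_num] at *
  calc Real.exp (-b * (Real.log u) ^ 2) * (1 + u) ^ N / u = (1 + u) ^ N * (Real.exp (-b * (Real.log u) ^ 2) / u) := by ring
    _ ≤ 2 ^ N * Real.exp (1 / (4 * b)) := mul_le_mul h1 h2 (by positivity) (by positivity)

/-- Pointwise bound of the window integrand on `[1, ∞)`. [folklore] -/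
theorem exp_neg_mul_log_sq_le_of_one_le {b : ℝ} (hb : 0 < b) (N : ℕ) {u : ℝ} (hu : 1 ≤ u) :
    Real.exp (-b * (Real.log u) ^ 2) * (1 + u) ^ N / u ≤ 2 ^ N * Real.exp (((N : ℝ) + 1) ^ 2 / (4 * b)) * u ^ (-(2 : ℝ)) := by
  have hu0 : 0 < u := by linarith
  have h1 : (1 + u) ^ N ≤ 2 ^ N * u ^ N := by
    rw [← mul_pow]; exact pow_le_pow_left₀ (by linarith) (by linarith) N
  have h2 : Real.exp (-b * (Real.log u) ^ 2) * u ^ (N + 1) ≤ Real.exp (((N : ℝ) + 1) ^ 2 / (4 * b)) := by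
    have h3 := exp_neg_mul_sq_mul_exp_le hb ((N : ℝ) + 1) (Real.log u)
    have h4 : Real.exp (((N : ℝ) + 1) * Real.log u) = u ^ (N + 1) := by
      rw [← Real.log_rpow hu0, Real.exp_log (Real.rpow_pos_of_pos hu0 _)]
      norm_cast
    rwa [h4] at h3
  have hu2 : u ^ (-(2 : ℝ)) = (u ^ 2)⁻¹ := by
    rw [Real.rpow_neg hu0.le, show (2 : ℝ) = ((2 : ℕ) : ℝ) by norm_num, Real.rpow_natCast]
  rw [hu2, div_le_iff₀ hu0]
  calc Real.exp (-b * (Real.log u) ^ 2) * (1 + u) ^ N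
      ≤ Real.exp (-b * (Real.log u) ^ 2) * (2 ^ N * u ^ N) := mul_le_mul_of_nonneg_left h1 (Real.exp_pos _).le
    _ = 2 ^ N * (Real.exp (-b * (Real.log u) ^ 2) * u ^ (N + 1)) * (u ^ 2)⁻¹ * u := by field_simp; ring
    _ ≤ 2 ^ N * Real.exp (((N : ℝ) + 1) ^ 2 / (4 * b)) * (u ^ 2)⁻¹ * u := by gcongr

/-- **The window integral**: `∫₀^∞ e^{-b log²u} (1+u)ᴺ du/u ≤ logWindowConst b N`. [folklore] -/
theorem setIntegral_exp_neg_mul_log_sq_le {b : ℝ} (hb : 0 < b) (N : ℕ) :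
    ∫ u in Ioi (0 : ℝ), Real.exp (-b * (Real.log u) ^ 2) * (1 + u) ^ N / u ≤ logWindowConst b N := by
  have hint := integrableOn_exp_neg_mul_log_sq hb N
  have hsplit : Ioi (0 : ℝ) = Ioc 0 1 ∪ Ioi 1 := (Ioc_union_Ioi_eq_Ioi zero_le_one).symm
  have hdisj : Disjoint (Ioc (0 : ℝ) 1) (Ioi 1) := Set.disjoint_left.2 fun u hu hu' => not_lt.2 hu.2 hu'
  rw [hsplit, setIntegral_union hdisj measurableSet_Ioi
    (hint.mono_set (by rw [hsplit]; exact subset_union_left)) (hint.mono_set (by rw [hsplit]; exact subset_union_right))]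
  have hA : ∫ u in Ioc (0 : ℝ) 1, Real.exp (-b * (Real.log u) ^ 2) * (1 + u) ^ N / u ≤ 2 ^ N * Real.exp (1 / (4 * b)) := by
    have h1 : ∫ u in Ioc (0 : ℝ) 1, Real.exp (-b * (Real.log u) ^ 2) * (1 + u) ^ N / u ≤
        ∫ _ in Ioc (0 : ℝ) 1, 2 ^ N * Real.exp (1 / (4 * b)) := by
      refine setIntegral_mono_on (hint.mono_set (by rw [hsplit]; exact subset_union_left))
        (integrableOn_const (by simp)) measurableSet_Ioc fun u hu => ?_
      exact exp_neg_mul_log_sq_le_of_le_one hb N hu.1 hu.2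
    refine h1.trans (le_of_eq ?_)
    rw [setIntegral_const]
    simp
  have hB : ∫ u in Ioi (1 : ℝ), Real.exp (-b * (Real.log u) ^ 2) * (1 + u) ^ N / u ≤
      2 ^ N * Real.exp (((N : ℝ) + 1) ^ 2 / (4 * b)) := by
    have h1 : ∫ u in Ioi (1 : ℝ), Real.exp (-b * (Real.log u) ^ 2) * (1 + u) ^ N / u ≤
        ∫ u in Ioi (1 : ℝ), 2 ^ N * Real.exp (((N : ℝ) + 1) ^ 2 / (4 * b)) * u ^ (-(2 : ℝ)) := by
      refine setIntegral_mono_on (hint.mono_set (by rw [hsplit]; exact subset_union_right))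
        ((integrableOn_Ioi_rpow_of_lt (by norm_num) zero_lt_one).const_mul _) measurableSet_Ioi fun u hu => ?_
      exact exp_neg_mul_log_sq_le_of_one_le hb N (le_of_lt hu)
    refine h1.trans (le_of_eq ?_)
    rw [integral_const_mul, integral_Ioi_rpow_of_lt (by norm_num) zero_lt_one]
    norm_num
  unfold logWindowConst
  linarith

/-- **The weighted integral of the logarithmic weight**: `∫ ‖logW b θ u‖ (1+|u|)ᴺ du ≤ M logWindowConst b N`
for `‖θ‖ ≤ M`. [folklore] -/
theorem integral_norm_logW_mul_pow_le {b : ℝ} (hb : 0 < b) {θ : ℝ → ℂ} (hθ : Continuous θ)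
    {M : ℝ} (hM : ∀ s, ‖θ s‖ ≤ M) (N : ℕ) :
    ∫ u : ℝ, ‖logW b θ u‖ * (1 + |u|) ^ N ≤ M * logWindowConst b N := by
  have hM0 : 0 ≤ M := (norm_nonneg _).trans (hM 0)
  have hsupp : (fun u : ℝ => ‖logW b θ u‖ * (1 + |u|) ^ N) =
      (Ioi (0 : ℝ)).indicator fun u => ‖logW b θ u‖ * (1 + |u|) ^ N := by
    funext u
    by_cases hu : 0 < u
    · rw [indicator_of_mem (mem_Ioi.2 hu)]
    · rw [indicator_of_notMem (fun h => hu (mem_Ioi.1 h)), logW_of_nonpos (not_lt.1 hu), norm_zero, zero_mul]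
  rw [hsupp, integral_indicator measurableSet_Ioi]
  have hint := integrable_norm_logW_mul_pow hb hθ hM N
  rw [hsupp, integrable_indicator_iff measurableSet_Ioi] at hint
  calc ∫ u in Ioi (0 : ℝ), ‖logW b θ u‖ * (1 + |u|) ^ N
      ≤ ∫ u in Ioi (0 : ℝ), M * (Real.exp (-b * (Real.log u) ^ 2) * (1 + u) ^ N / u) := by
        refine setIntegral_mono_on hint (((integrableOn_exp_neg_mul_log_sq hb N).const_mul M)) measurableSet_Ioi
          fun u (hu : 0 < u) => ?_
        rw [norm_logW_of_pos hu, abs_of_pos hu]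
        calc Real.exp (-b * (Real.log u) ^ 2) * ‖θ (Real.log u)‖ / u * (1 + u) ^ N
            = ‖θ (Real.log u)‖ * (Real.exp (-b * (Real.log u) ^ 2) * (1 + u) ^ N / u) := by ring
          _ ≤ M * (Real.exp (-b * (Real.log u) ^ 2) * (1 + u) ^ N / u) :=
              mul_le_mul_of_nonneg_right (hM _) (by positivity)
    _ = M * ∫ u in Ioi (0 : ℝ), Real.exp (-b * (Real.log u) ^ 2) * (1 + u) ^ N / u := integral_const_mul _ _
    _ ≤ M * logWindowConst b N := mul_le_mul_of_nonneg_left (setIntegral_exp_neg_mul_log_sq_le hb N) hM0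

/-! ### The slot bounds -/

/-- **Explicit slot bound**: `slotB i b C N θ ≤ C (M · logWindowConst b N)ᵏ` when `‖θⱼ‖ ≤ M`. [folklore] -/
theorem LogSlot.slotB_le {k : ℕ} (i : Fin (k + 1)) {b : ℝ} (hb : 0 < b) {C : ℝ} (hC : 0 ≤ C) (N : ℕ)
    (θ : Fin (k + 1) → 𝓢(ℝ, ℂ)) {M : ℝ} (hM : ∀ j s, ‖θ j s‖ ≤ M) :
    LogSlot.slotB i b C N (fun j => ⇑(θ j)) ≤ C * (M * logWindowConst b N) ^ k := by
  have hM0 : 0 ≤ M := (norm_nonneg _).trans (hM 0 0)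
  have hint1 : Integrable fun u' : Fin k → ℝ => ∏ j, (‖logW b (θ (i.succAbove j)) (u' j)‖ * (1 + |u' j|) ^ N) :=
    Integrable.fintype_prod (f := fun j (x : ℝ) => ‖logW b (θ (i.succAbove j)) x‖ * (1 + |x|) ^ N)
      fun j => integrable_norm_logW_mul_pow hb (θ _).continuous (hM _) N
  unfold LogSlot.slotB
  calc ∫ u' : Fin k → ℝ, (∏ j, ‖logW b (θ (i.succAbove j)) (u' j)‖) * (C * (1 + ‖u'‖) ^ N)
      ≤ ∫ u' : Fin k → ℝ, C * ∏ j, (‖logW b (θ (i.succAbove j)) (u' j)‖ * (1 + |u' j|) ^ N) := by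
        refine integral_mono (LogSlot.integrable_prod_norm_logW_mul_pow hb θ hC N) (hint1.const_mul C) fun u' => ?_
        have h1 : (1 + ‖u'‖) ^ N ≤ ∏ j, (1 + |u' j|) ^ N := one_add_norm_pow_le_prod u' N
        calc (∏ j, ‖logW b (θ (i.succAbove j)) (u' j)‖) * (C * (1 + ‖u'‖) ^ N)
            ≤ (∏ j, ‖logW b (θ (i.succAbove j)) (u' j)‖) * (C * ∏ j, (1 + |u' j|) ^ N) := by gcongr
          _ = C * ∏ j, (‖logW b (θ (i.succAbove j)) (u' j)‖ * (1 + |u' j|) ^ N) := by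
              rw [Finset.prod_mul_distrib]; ring
    _ = C * ∏ j : Fin k, ∫ x : ℝ, ‖logW b (θ (i.succAbove j)) x‖ * (1 + |x|) ^ N := by
        rw [integral_const_mul]
        congr 1
        exact integral_fin_nat_prod_volume_eq_prod (𝕜 := ℝ) (fun j (x : ℝ) => ‖logW b (θ (i.succAbove j)) x‖ * (1 + |x|) ^ N)
    _ ≤ C * ∏ _j : Fin k, (M * logWindowConst b N) := by
        refine mul_le_mul_of_nonneg_left (Finset.prod_le_prod (fun j _ => integral_nonneg fun x => by positivity)
          fun j _ => integral_norm_logW_mul_pow_le hb (θ _).continuous (hM _) N) hC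
    _ = C * (M * logWindowConst b N) ^ k := by rw [Finset.prod_const, Finset.card_univ, Fintype.card_fin]

/-- The Gaussian profile is bounded by one. [folklore] -/
theorem norm_gauss_le_one {b : ℝ} (hb : 0 ≤ b) (s : ℝ) : ‖Complex.exp (-(b : ℂ) * (s : ℂ) ^ 2)‖ ≤ 1 := by
  rw [Complex.norm_exp]
  have h : (-(b : ℂ) * (s : ℂ) ^ 2).re = -b * s ^ 2 := by
    have : (-(b : ℂ) * (s : ℂ) ^ 2) = ((-b * s ^ 2 : ℝ) : ℂ) := by push_cast; ring
    rw [this, Complex.ofReal_re]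
  rw [h, Real.exp_le_one_iff]
  nlinarith [sq_nonneg s]

/-- **Explicit maximal slot bound at Gaussian profiles**: for nonnegative slot constants `Cᵢ ≤ Cmax`
and a constant order `N`, `slotBmax b C N ≤ Cmax · (logWindowConst b N)ᵏ`. [folklore] -/
theorem LogSlot.slotBmax_le {k : ℕ} {b : ℝ} (hb : 0 < b) {C : Fin (k + 1) → ℝ} (hC : ∀ i, 0 ≤ C i) {Cmax : ℝ}
    (hCle : ∀ i, C i ≤ Cmax) (N : ℕ) :
    LogSlot.slotBmax b C (fun _ => N) ≤ Cmax * logWindowConst b N ^ k := by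
  obtain ⟨γ, hγ⟩ : ∃ γ : 𝓢(ℝ, ℂ), ∀ s : ℝ, γ s = Complex.exp (-(b : ℂ) * (s : ℂ) ^ 2) := by
    obtain ⟨φ, hφ⟩ := exists_schwartzMap_gaussMod hb 0
    exact ⟨φ, fun s => by rw [hφ s]; simp⟩
  have hγfun : (fun _ : Fin (k + 1) => fun s : ℝ => Complex.exp (-(b : ℂ) * (s : ℂ) ^ 2)) = fun j => ⇑((fun _ => γ) j) :=
    funext fun _ => funext fun s => (hγ s).symm
  refine Finset.sup'_le _ _ fun i _ => ?_
  rw [hγfun]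
  refine (LogSlot.slotB_le i hb (hC i) N (fun _ => γ) (M := 1) fun _ s => by rw [hγ s]; exact norm_gauss_le_one hb.le s).trans ?_
  rw [one_mul]
  exact mul_le_mul_of_nonneg_right (hCle i) (pow_nonneg (logWindowConst_pos b N).le _)

/-! ### The tube constant -/

/-- The `b`-free tail integral of the tube bound: `∫ e^{-2π(c₁ - c)‖p‖} dp`, `c₁ = (c + π/2)/2`. [folklore] -/
def tubeTail (K : ℕ) (c : ℝ) : ℝ := ∫ p : Fin (K + 1) → ℝ, Real.exp (-(2 * π * ((c + π / 2) / 2 - c)) * ‖p‖)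

/-- **The unit tube constant as a function of the window**:
`l1TubeBound (π/2) b 0 (K+1) 1 0 c = e^{2bc₁²} √(π/(2b)) · tubeTail K c`. [folklore] -/
theorem l1TubeBound_unit_eq (b : ℝ) (K : ℕ) (c : ℝ) :
    l1TubeBound (π / 2) b 0 (K + 1) (fun _ => 1) (fun _ => 0) c =
      Real.exp (2 * b * (max ((c + π / 2) / 2) 0) ^ 2) * Real.sqrt (π / (2 * b)) * tubeTail K c := by
  unfold l1TubeBound l1TubeDecayConst tubeTail
  have hg : ∫ x : ℝ, Real.exp (0 * |x| - 2 * b * x ^ 2) = Real.sqrt (π / (2 * b)) := by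
    have h := integral_gaussian (2 * b)
    simp only [zero_mul, zero_sub] at *
    convert h using 2
    funext x; ring_nf
  rw [hg, ← integral_const_mul]
  refine integral_congr_ae (Eventually.of_forall fun p => ?_)
  simp only [pow_zero, one_mul]

end Literature.MathematicalPhysics.QuantumFieldTheory
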